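import Summits.QuantumFields.BalabanUV.Beta.GAN24.ContactTentFaceAvg
import Summits.QuantumFields.BalabanUV.Beta.GAN24.StaircasePairingReadings

/-!
# `BalabanUV.Beta.GAN24.ContactRefineP` — binder row G-an2-4 / (CONV-C), the row owner's CONTACT-TERM ROUTE, CT-4c SHAPE P (leaf-01 g61's split
# `CT4CE-BLUEPRINT-v0.md` §3 ∕ §5 M4, road-P2 chair): **THE STAIRCASE PAIRING OF THE TALLER TOWER AGAINST THE SHORTER TOWER's, DIFFERENCED** —
# `pair′(t′, ψ′, χ′) − c₀·pair(𝒬ᵀ_N φ, ψ, χ) = pair′(t′, ψ′ − ψ̃, χ′) + pair′(t′, ψ̃, χ′ − χ̃) + pair(𝒬ᵀ_N φ̃, ψ, χ)` EXACTLY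
# (`ψ̃ = c_ψ·ψ ∘ blk P`, `χ̃ = c_χ·χ ∘ blk P`, `φ̃ = (c_ψc_χP^{d+1})•φ′ − c₀•φ`; M5 `ContactTentFaceAvg` for the third bracket), and the three brackets bounded by
# the owner's `StaircasePairing.abs_pairing_le_sum` in leaf-03's bond-reading form `StaircasePairingReadings.abs_pairingReading_le_sum` VERBATIM: two on the fine′ lattice (`k+2` scales, block `P·N`), one on the coarse lattice (`k+1` scales, block `N`).

NOT IN PRINT; OUR BOOKKEEPING (road-P2 chair `b2b-balaban-gan24-p2`, gen 34; «MINE (CT-4c-P)» journal 2026-08-21T19:46Z; GENERIC `d`).  HONEST FRAMING (cell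
contract, verbatim): «discharging `BetaPertH` makes Bałaban's UV stability UNCONDITIONAL — a real constructive-QFT result; it is NOT the continuum limit and NOT
the Clay problem.»  HONEST DEPENDENCY (verbatim): «continuum YM on T⁴ ⇐ BetaPertH ∧ nine spine estimates (0/9 proved); BetaPertH ⇐ (D1) ∧ (D4) ∧ CAP+tail;
G-an2-4 gates asym, D1 and NE2/3/4.»

WHAT (`pair(t, ψ, χ) := Σ'_u t κ u·(θ₀·ψ u + θ₁·ψ (u+e_κ))·(χ (u+e_κ) − χ u)`, any bond reading with `|θ₀| + |θ₁| ≤ 1` — midpoint `(½,½)`, tip `(0,1)`,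
base `(1,0)`; written out; no `def`).
* §1 helpers: `abs_staircase_le` (a staircase with per-scale letters `a s` is bounded by `(Σ_s a s)·E`), `summable_pairing_of_env` (tent × staircase × staircase
  summands are summable on the envelopes' summable class; one-step wobble `StaircaseFaces.env_add_unitVec_le`), `contourSumAdj_smul_sub_apply`,
  `abs_contourSumAdj_coarse_le_of_fine` (the coarse tent of the taller kernel is `P⁻¹ ×` a far-face value of the fine′ tent — M5 — hence inherits its envelope).
* §2 **`pairing_refine_eq`** — the three-bracket identity above, under the five summabilities it needs (all discharged in §3 from envelopes).
* §3 **`abs_pairing_refine_le`** — THE SCHEMA: given (a) the fine′ tent `t′ = 𝒬ᵀ_{P·N} φ′` with letters `(Φ₀′, τ′)`, (b) the coarse DIFFERENCE kernel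
  `φ̃ = (c_ψc_χ(P^d·P))•φ′ − c₀•φ` with letters `(Φ̃₀, τ̃)` (the consumer's CT-4d `ContactTentCauchy` letter at his currency `c₀`) and the shorter tower's tent letter
  `τ₀`, (c) the four fine′ staircases `ψ′ − c_ψ·ψ∘blk P`, `c_ψ·ψ∘blk P`, `χ′`, `χ′ − c_χ·χ∘blk P` (CT-4b `ContactGaugeStaircaseCauchyPack` clauses (v)(iii)(i)(v))
  with letters `aΔ, aup, b′, bΔ`, (d) the two coarse staircases `ψ, χ` with letters `a, b`, all at one rate `κ₀`, and the two summable envelope classes: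
  `|pair′(t′,ψ′,χ′) − c₀·pair(𝒬ᵀ_N φ,ψ,χ)| ≤ W_{k+1}(τ′,Φ₀′; aΔ, b′)·S′ + W_{k+1}(τ′,Φ₀′; aup, bΔ)·S′ + W_k(τ̃,Φ̃₀; a, b)·S` with `W` the owner's double weight sums
  (left explicit: the `s₁ = 0` row of the first two carries the (δ) piece, the rest is geometric — `sum_weights_le_of_geometric` on the consumer's side).
[folklore] throughout; 0 `def`, 0 cited facts, 0 `def … : Prop`, 0 sorry.  NO new estimate; discharges NOTHING of hSdev by itself (the owner's CT-4e instantiates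
the schema on the 8 atoms with CT-4a∕4b∕4d and leaf-01's SHAPE-A modules); 0 wall binders; NEVER «G-an2-4 closed»; NOT (CONV-C) as typed, NOT D1, NOT BetaPertH,
NOT continuum, NOT Clay.
-/

noncomputable section

open Finset
open scoped BigOperators
open Literature.MathematicalPhysics.QuantumFieldTheory
open Literature.MathematicalPhysics.QuantumFieldTheory.LatticeForm (quo)
open Literature.MathematicalPhysics.QuantumFieldTheory.Balaban1983to89
open Literature.MathematicalPhysics.QuantumFieldTheory.Balaban1983to89.Beta
open B4ContourShift (supNorm supNorm_nonneg)
open AffineAveraging (Form0 Form1 Site box toSite unitVec)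
open AffineReproduction (contourSumAdj)
open AveragingContours (blk blk_block)
open KKTFluctuationEnergy (contourSumAdj_eq)
open Summit.QuantumFields.BalabanUV.Beta.GAN24.StaircaseFaces (env_add_unitVec_le quo_quo card_box_filter_last)
open Summit.QuantumFields.BalabanUV.Beta.GAN24.StaircasePairingReadings (abs_pairingReading_le_sum)
open Summit.QuantumFields.BalabanUV.Beta.GAN24.ContactTentFaceAvg (mem_box_iff contourSumAdj_mul_apply_farFace tsum_transport_pairingReading_contourSumAdj)

namespace Summit.QuantumFields.BalabanUV.Beta.GAN24.ContactRefineP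

variable {d : ℕ}

/-! ## §1 Helpers -/

section Helpers

variable {N : ℕ} {κ₀ : ℝ}

/-- [folklore] A staircase with per-scale letters is bounded by the sum of its letters times the common envelope. -/
theorem abs_staircase_le {P k : ℕ} {G : ℕ → Form0 (d + 1) ℝ} {a : ℕ → ℝ} {c : Site (d + 1)} {ψ : Form0 (d + 1) ℝ}
    (hψ : ∀ u, ψ u = ∑ s ∈ Finset.range (k + 1), G s (blk (P ^ s) u))
    (hG : ∀ s, s ≤ k → ∀ u, |G s (blk (P ^ s) u)| ≤ a s * Real.exp (-(κ₀ * supNorm (quo N u - c)))) (u : Site (d + 1)) :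
    |ψ u| ≤ (∑ s ∈ Finset.range (k + 1), a s) * Real.exp (-(κ₀ * supNorm (quo N u - c))) := by
  rw [hψ u, Finset.sum_mul]
  exact (Finset.abs_sum_le_sum_abs _ _).trans (Finset.sum_le_sum fun s hs => hG s (Nat.lt_succ_iff.1 (Finset.mem_range.1 hs)) u)

/-- [folklore] **TENT × STAIRCASE-READING × STAIRCASE-JUMP SUMMANDS ARE SUMMABLE** on the summable class of the three envelopes (any bond reading
`θ₀·ψ u + θ₁·ψ (u+e_κ)` with `|θ₀| + |θ₁| ≤ 1`; one-step wobble `StaircaseFaces.env_add_unitVec_le` on the shifted factors). -/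
theorem summable_pairing_of_env [NeZero N] (hκ : 0 ≤ κ₀) {t : Form1 (d + 1) ℝ} {ψ χ : Form0 (d + 1) ℝ} {τ A B θ₀ θ₁ : ℝ}
    {y₀ c₁ c₂ : Site (d + 1)} (hθ : |θ₀| + |θ₁| ≤ 1)
    (ht : ∀ κ u, |t κ u| ≤ τ * Real.exp (-(κ₀ * supNorm (quo N u - y₀))))
    (hψ : ∀ u, |ψ u| ≤ A * Real.exp (-(κ₀ * supNorm (quo N u - c₁))))
    (hχ : ∀ u, |χ u| ≤ B * Real.exp (-(κ₀ * supNorm (quo N u - c₂))))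
    (hE : Summable fun u : Site (d + 1) => Real.exp (-(κ₀ * supNorm (quo N u - y₀))) * Real.exp (-(κ₀ * supNorm (quo N u - c₁))) *
      Real.exp (-(κ₀ * supNorm (quo N u - c₂))))
    (κ : Fin (d + 1)) :
    Summable fun u => t κ u * (θ₀ * ψ u + θ₁ * ψ (u + unitVec κ)) * (χ (u + unitVec κ) - χ u) := by
  -- a letter that bounds an absolute value against a positive envelope is nonnegative (cf. lit-balaban's `InfiniteVolumeRate.nonneg_of_abs_le_mul_exp`)
  have hnn : ∀ {x a e : ℝ}, |x| ≤ a * Real.exp e → 0 ≤ a := fun {x a e} h =>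
    le_of_mul_le_mul_right (by rw [zero_mul]; exact (abs_nonneg x).trans h) (Real.exp_pos e)
  have hτ : 0 ≤ τ := hnn (ht κ 0)
  have hA : 0 ≤ A := hnn (hψ 0)
  have hB : 0 ≤ B := hnn (hχ 0)
  refine Summable.of_norm_bounded (hE.mul_left (τ * (A * Real.exp κ₀) * (2 * B * Real.exp κ₀))) fun u => ?_
  rw [Real.norm_eq_abs, abs_mul, abs_mul]
  set E₀ := Real.exp (-(κ₀ * supNorm (quo N u - y₀))) with hE₀
  set E₁ := Real.exp (-(κ₀ * supNorm (quo N u - c₁))) with hE₁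
  set E₂ := Real.exp (-(κ₀ * supNorm (quo N u - c₂))) with hE₂
  have h1 : 1 ≤ Real.exp κ₀ := Real.one_le_exp hκ
  have hE₁0 : 0 ≤ E₁ := (Real.exp_pos _).le
  have hE₂0 : 0 ≤ E₂ := (Real.exp_pos _).le
  have hψ' : |ψ (u + unitVec κ)| ≤ A * (Real.exp κ₀ * E₁) :=
    (hψ _).trans (mul_le_mul_of_nonneg_left (env_add_unitVec_le (N := N) hκ c₁ u κ) hA)
  have hχ' : |χ (u + unitVec κ)| ≤ B * (Real.exp κ₀ * E₂) :=
    (hχ _).trans (mul_le_mul_of_nonneg_left (env_add_unitVec_le (N := N) hκ c₂ u κ) hB)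
  have hψ0 : |ψ u| ≤ A * (Real.exp κ₀ * E₁) := (hψ u).trans (by nlinarith [mul_nonneg hA hE₁0])
  have hread : |θ₀ * ψ u + θ₁ * ψ (u + unitVec κ)| ≤ A * Real.exp κ₀ * E₁ := by
    have h0 := abs_nonneg θ₀
    have h1' := abs_nonneg θ₁
    calc |θ₀ * ψ u + θ₁ * ψ (u + unitVec κ)| ≤ |θ₀| * |ψ u| + |θ₁| * |ψ (u + unitVec κ)| := by
          rw [← abs_mul, ← abs_mul]; exact abs_add_le _ _
      _ ≤ |θ₀| * (A * (Real.exp κ₀ * E₁)) + |θ₁| * (A * (Real.exp κ₀ * E₁)) :=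
          add_le_add (mul_le_mul_of_nonneg_left hψ0 h0) (mul_le_mul_of_nonneg_left hψ' h1')
      _ = (|θ₀| + |θ₁|) * (A * Real.exp κ₀ * E₁) := by ring
      _ ≤ 1 * (A * Real.exp κ₀ * E₁) := mul_le_mul_of_nonneg_right hθ (by positivity)
      _ = A * Real.exp κ₀ * E₁ := one_mul _
  have hjump : |χ (u + unitVec κ) - χ u| ≤ 2 * B * Real.exp κ₀ * E₂ := by
    have := (abs_sub _ _).trans (add_le_add hχ' (hχ u))
    nlinarith [mul_nonneg hB hE₂0]
  calc |t κ u| * |θ₀ * ψ u + θ₁ * ψ (u + unitVec κ)| * |χ (u + unitVec κ) - χ u|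
      ≤ (τ * E₀) * (A * Real.exp κ₀ * E₁) * (2 * B * Real.exp κ₀ * E₂) :=
        mul_le_mul (mul_le_mul (ht κ u) hread (abs_nonneg _) (by positivity)) hjump (abs_nonneg _) (by positivity)
    _ = τ * (A * Real.exp κ₀) * (2 * B * Real.exp κ₀) * (E₀ * E₁ * E₂) := by ring

/-- [folklore] `𝒬ᵀ_N` is linear in the kernel, pointwise: `𝒬ᵀ_N (a•φ′ − c•φ) κ w = a·𝒬ᵀ_N φ′ κ w − c·𝒬ᵀ_N φ κ w`. -/
theorem contourSumAdj_smul_sub_apply (N : ℕ) (a c : ℝ) (φ' φ : Form1 (d + 1) ℝ) (κ : Fin (d + 1)) (w : Site (d + 1)) :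
    contourSumAdj N (a • φ' - c • φ) κ w = a * contourSumAdj N φ' κ w - c * contourSumAdj N φ κ w := by
  simp only [contourSumAdj_eq, Pi.sub_apply, Pi.smul_apply, smul_eq_mul, Finset.sum_sub_distrib, Finset.mul_sum]

/-- [folklore] **THE COARSE TENT OF THE TALLER KERNEL INHERITS THE FINE′ TENT's ENVELOPE** (`1 ≤ P`): `|𝒬ᵀ_N φ′ κ w| ≤ τ′·e^{−κ₀‖quo N w − y₀‖∞}` whenever
`|𝒬ᵀ_{P·N} φ′ κ u′| ≤ τ′·e^{−κ₀‖quo (P·N) u′ − y₀‖∞}` — read the fine′ tent at a far-face site of the cell of `w` (M5: value `P·𝒬ᵀ_N φ′ κ w`, `P ≥ 1`). -/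
theorem abs_contourSumAdj_coarse_le_of_fine {P : ℕ} (hP : 1 ≤ P) (N : ℕ) {φ' : Form1 (d + 1) ℝ} {τ' : ℝ} {y₀ : Site (d + 1)}
    (ht' : ∀ κ u', |contourSumAdj (P * N) φ' κ u'| ≤ τ' * Real.exp (-(κ₀ * supNorm (quo (P * N) u' - y₀))))
    (κ : Fin (d + 1)) (w : Site (d + 1)) :
    |contourSumAdj N φ' κ w| ≤ τ' * Real.exp (-(κ₀ * supNorm (quo N w - y₀))) := by
  haveI : NeZero P := ⟨by omega⟩
  -- the far-face offset `r = (P−1, …, P−1)`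
  set r : Fin (d + 1) → ℕ := fun _ => P - 1 with hr
  have hrbox : r ∈ box (d + 1) P := mem_box_iff.2 fun _ => by simp only [hr]; omega
  have hface := contourSumAdj_mul_apply_farFace P N φ' κ w hrbox (by simp only [hr])
  have hP0 : (0 : ℝ) < P := by exact_mod_cast hP
  have hlab : quo (P * N) ((P : ℤ) • w + toSite r) = quo N w := by
    rw [← quo_quo, show quo P ((P : ℤ) • w + toSite r) = blk P ((P : ℤ) • w + toSite r) from rfl, blk_block w hrbox]
  have h := ht' κ ((P : ℤ) • w + toSite r)
  rw [hface, hlab, abs_mul, abs_of_pos hP0] at h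
  have h1 : (1 : ℝ) ≤ P := by exact_mod_cast hP
  have hτ : 0 ≤ τ' * Real.exp (-(κ₀ * supNorm (quo N w - y₀))) := le_trans (by positivity) h
  nlinarith

end Helpers

/-! ## §2 The three-bracket identity -/

/-- NOT IN PRINT; OUR BOOKKEEPING.  **SHAPE P, DIFFERENCED ACROSS TWO TOWERS — EXACTLY THREE STAIRCASE PAIRINGS** (generic `d`, `1 ≤ P`; any bond reading
`θ₀·ψ u + θ₁·ψ (u+e_κ)`; `t′ = 𝒬ᵀ_{P·N} φ′` the taller tower's tent, `ψ′, χ′` its two staircases on the fine′ lattice; `𝒬ᵀ_N φ`, `ψ, χ` the shorter tower's;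
`c_ψ, c_χ, c₀` the consumer's currency factors):
`pair′(t′, ψ′, χ′) − c₀·pair(𝒬ᵀ_N φ, ψ, χ) = pair′(t′, ψ′ − c_ψ·ψ∘blk P, χ′) + pair′(t′, c_ψ·ψ∘blk P, χ′ − c_χ·χ∘blk P) + pair(𝒬ᵀ_N((c_ψc_χ(P^d·P))•φ′ − c₀•φ), ψ, χ)`
— trilinearity, then M5 `tsum_transport_pairingReading_contourSumAdj` turns the transported bracket into a coarse pairing and `𝒬ᵀ_N` is linear in the kernel.
The five summabilities are hypotheses here (§3 discharges them from envelopes). -/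
theorem pairing_refine_eq {P : ℕ} (hP : 1 ≤ P) (N : ℕ) (φ' φ : Form1 (d + 1) ℝ) (ψ' χ' ψ χ : Form0 (d + 1) ℝ) (cψ cχ c₀ θ₀ θ₁ : ℝ)
    (κ : Fin (d + 1))
    (hS1 : Summable fun u' : Site (d + 1) => contourSumAdj (P * N) φ' κ u'
      * (θ₀ * (ψ' u' - cψ * ψ (blk P u')) + θ₁ * (ψ' (u' + unitVec κ) - cψ * ψ (blk P (u' + unitVec κ))))
      * (χ' (u' + unitVec κ) - χ' u'))
    (hS2 : Summable fun u' : Site (d + 1) => contourSumAdj (P * N) φ' κ u'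
      * (θ₀ * (cψ * ψ (blk P u')) + θ₁ * (cψ * ψ (blk P (u' + unitVec κ))))
      * ((χ' (u' + unitVec κ) - cχ * χ (blk P (u' + unitVec κ))) - (χ' u' - cχ * χ (blk P u'))))
    (hS3 : Summable fun u' : Site (d + 1) => contourSumAdj (P * N) φ' κ u'
      * (θ₀ * (cψ * ψ (blk P u')) + θ₁ * (cψ * ψ (blk P (u' + unitVec κ)))) * (cχ * χ (blk P (u' + unitVec κ)) - cχ * χ (blk P u')))
    (hS4 : Summable fun w : Site (d + 1) => contourSumAdj N φ' κ w * (θ₀ * ψ w + θ₁ * ψ (w + unitVec κ)) * (χ (w + unitVec κ) - χ w))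
    (hS5 : Summable fun w : Site (d + 1) => contourSumAdj N φ κ w * (θ₀ * ψ w + θ₁ * ψ (w + unitVec κ)) * (χ (w + unitVec κ) - χ w)) :
    (∑' u' : Site (d + 1), contourSumAdj (P * N) φ' κ u' * (θ₀ * ψ' u' + θ₁ * ψ' (u' + unitVec κ)) * (χ' (u' + unitVec κ) - χ' u'))
      - c₀ * ∑' w : Site (d + 1), contourSumAdj N φ κ w * (θ₀ * ψ w + θ₁ * ψ (w + unitVec κ)) * (χ (w + unitVec κ) - χ w)
    = (∑' u' : Site (d + 1), contourSumAdj (P * N) φ' κ u'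
          * (θ₀ * (ψ' u' - cψ * ψ (blk P u')) + θ₁ * (ψ' (u' + unitVec κ) - cψ * ψ (blk P (u' + unitVec κ))))
          * (χ' (u' + unitVec κ) - χ' u'))
      + (∑' u' : Site (d + 1), contourSumAdj (P * N) φ' κ u'
          * (θ₀ * (cψ * ψ (blk P u')) + θ₁ * (cψ * ψ (blk P (u' + unitVec κ))))
          * ((χ' (u' + unitVec κ) - cχ * χ (blk P (u' + unitVec κ))) - (χ' u' - cχ * χ (blk P u'))))
      + ∑' w : Site (d + 1), contourSumAdj N ((cψ * cχ * ((P : ℝ) ^ d * P)) • φ' - c₀ • φ) κ w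
          * (θ₀ * ψ w + θ₁ * ψ (w + unitVec κ)) * (χ (w + unitVec κ) - χ w) := by
  -- trilinearity, pointwise
  have hsplit : ∀ u' : Site (d + 1),
      contourSumAdj (P * N) φ' κ u' * (θ₀ * ψ' u' + θ₁ * ψ' (u' + unitVec κ)) * (χ' (u' + unitVec κ) - χ' u')
        = contourSumAdj (P * N) φ' κ u'
            * (θ₀ * (ψ' u' - cψ * ψ (blk P u')) + θ₁ * (ψ' (u' + unitVec κ) - cψ * ψ (blk P (u' + unitVec κ))))
            * (χ' (u' + unitVec κ) - χ' u')
          + contourSumAdj (P * N) φ' κ u'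
            * (θ₀ * (cψ * ψ (blk P u')) + θ₁ * (cψ * ψ (blk P (u' + unitVec κ))))
            * ((χ' (u' + unitVec κ) - cχ * χ (blk P (u' + unitVec κ))) - (χ' u' - cχ * χ (blk P u')))
          + contourSumAdj (P * N) φ' κ u'
            * (θ₀ * (cψ * ψ (blk P u')) + θ₁ * (cψ * ψ (blk P (u' + unitVec κ)))) * (cχ * χ (blk P (u' + unitVec κ)) - cχ * χ (blk P u')) := by
    intro u'; ring
  rw [tsum_congr hsplit, (hS1.add hS2).tsum_add hS3, hS1.tsum_add hS2]
  -- the transported bracket is a coarse pairing (M5), with the constants pulled out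
  have hS3' : Summable fun u' : Site (d + 1) => contourSumAdj (P * N) φ' κ u'
      * (θ₀ * (fun w => cψ * ψ w) (blk P u') + θ₁ * (fun w => cψ * ψ w) (blk P (u' + unitVec κ)))
      * ((fun w => cχ * χ w) (blk P (u' + unitVec κ)) - (fun w => cχ * χ w) (blk P u')) := hS3
  have h3 := tsum_transport_pairingReading_contourSumAdj (d := d) hP N φ' (fun w => cψ * ψ w) (fun w => cχ * χ w) θ₀ θ₁ κ hS3'
  rw [h3]
  -- the coarse bracket: linearity of `𝒬ᵀ_N` in the kernel and of the series
  have hlin : ∀ w : Site (d + 1),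
      contourSumAdj N ((cψ * cχ * ((P : ℝ) ^ d * P)) • φ' - c₀ • φ) κ w * (θ₀ * ψ w + θ₁ * ψ (w + unitVec κ)) * (χ (w + unitVec κ) - χ w)
        = (cψ * cχ * ((P : ℝ) ^ d * P)) * (contourSumAdj N φ' κ w * (θ₀ * ψ w + θ₁ * ψ (w + unitVec κ)) * (χ (w + unitVec κ) - χ w))
          - c₀ * (contourSumAdj N φ κ w * (θ₀ * ψ w + θ₁ * ψ (w + unitVec κ)) * (χ (w + unitVec κ) - χ w)) := by
    intro w
    rw [contourSumAdj_smul_sub_apply]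
    ring
  have hcoarse : ∀ w : Site (d + 1),
      contourSumAdj N φ' κ w * (θ₀ * (fun w => cψ * ψ w) w + θ₁ * (fun w => cψ * ψ w) (w + unitVec κ))
          * ((fun w => cχ * χ w) (w + unitVec κ) - (fun w => cχ * χ w) w)
        = (cψ * cχ) * (contourSumAdj N φ' κ w * (θ₀ * ψ w + θ₁ * ψ (w + unitVec κ)) * (χ (w + unitVec κ) - χ w)) := by
    intro w; ring
  rw [tsum_congr hlin, tsum_congr hcoarse, tsum_mul_left, (hS4.mul_left _).tsum_sub (hS5.mul_left _), tsum_mul_left, tsum_mul_left]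
  ring

/-! ## §3 The schema: three applications of the owner's pairing lemma (in leaf-03's bond-reading form) -/

section Schema

variable {P N k : ℕ} [NeZero P] [NeZero N] {κ₀ τ' Φ₀' τt Φt τ₀ : ℝ} {y₀ c₁ c₂ : Site (d + 1)} {φ' φ : Form1 (d + 1) ℝ}
  {ψ' χ' ψ χ : Form0 (d + 1) ℝ} {cψ cχ c₀ θ₀ θ₁ : ℝ} {ΔG₁ Gup₁ G₂' ΔG₂ G₁ G₂ : ℕ → Form0 (d + 1) ℝ} {aΔ aup b' bΔ a b : ℕ → ℝ}

/-- NOT IN PRINT; OUR BOOKKEEPING.  **CT-4c SHAPE P — THE DIFFERENCED STAIRCASE PAIRING, BOUNDED** (generic `d`; the schema the owner's CT-4e instantiates on each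
SHAPE-P atom of the three cells; any bond reading `θ₀·ψ u + θ₁·ψ (u+e_κ)`, `|θ₀| + |θ₁| ≤ 1` — midpoint, tip, base).  DATA: the taller tower's tent `t′ = 𝒬ᵀ_{P·N} φ′` (letters `Φ₀′, τ′` at centre `y₀`); the coarse DIFFERENCE kernel
`φ̃ = (c_ψc_χ(P^d·P))•φ′ − c₀•φ` (letters `Φ̃₀, τ̃` — the consumer's CT-4d `ContactTentCauchy.abs_unitTent_sub_le` ∕ `abs_contourSumAdj_le` at his currency `c₀`) and
the shorter tower's tent letter `τ₀`; on the fine′ lattice (`k+2` scales, block `P·N`, `P^s ∣ P·N`) the four staircases `ψ′ − c_ψ·ψ∘blk P` (letters `aΔ`, centre `c₁`),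
`c_ψ·ψ∘blk P` (`aup`, `c₁`), `χ′` (`b′`, `c₂`), `χ′ − c_χ·χ∘blk P` (`bΔ`, `c₂`) — CT-4b `ContactGaugeStaircaseCauchyPack.exists_gauge_staircase_cauchy` clauses
(v)(vi) ∕ (iii)(iv) ∕ (i)(ii) ∕ (v)(vi) for the two source bonds; on the coarse lattice (`k+1` scales, block `N`) `ψ, χ` (letters `a, b`); the two summable envelope
classes.  CONCLUSION: `|pair′(t′, ψ′, χ′) − c₀·pair(𝒬ᵀ_N φ, ψ, χ)| ≤ W_{k+1}(τ′, Φ₀′; aΔ, b′)·S′ + W_{k+1}(τ′, Φ₀′; aup, bΔ)·S′ + W_k(τ̃, Φ̃₀; a, b)·S`, `W` the owner's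
double weight sums of `StaircasePairing.abs_pairing_le_sum` ∕ leaf-03's `StaircasePairingReadings.abs_pairingReading_le_sum`, VERBATIM (their `s₁ = 0` rows carry the taller tower's finest pieces — the (δ) count; the rest is geometric). -/
theorem abs_pairing_refine_le (hκ : 0 ≤ κ₀) (hτ' : 0 ≤ τ') (hΦ' : 0 ≤ Φ₀') (hτt : 0 ≤ τt) (hΦt : 0 ≤ Φt) (hP : 1 ≤ P)
    (hθ : |θ₀| + |θ₁| ≤ 1)
    (haΔ : ∀ s, 0 ≤ aΔ s) (haup : ∀ s, 0 ≤ aup s) (hb' : ∀ s, 0 ≤ b' s) (hbΔ : ∀ s, 0 ≤ bΔ s) (ha : ∀ s, 0 ≤ a s) (hb : ∀ s, 0 ≤ b s)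
    (hdvd' : ∀ s, s ≤ k + 1 → P ^ s ∣ P * N) (hdvd : ∀ s, s ≤ k → P ^ s ∣ N)
    (hφ' : ∀ κ y, |φ' κ y| ≤ Φ₀' * Real.exp (-(κ₀ * supNorm (y - y₀))))
    (ht' : ∀ κ u', |contourSumAdj (P * N) φ' κ u'| ≤ τ' * Real.exp (-(κ₀ * supNorm (quo (P * N) u' - y₀))))
    (hφt : ∀ κ y, |((cψ * cχ * ((P : ℝ) ^ d * P)) • φ' - c₀ • φ) κ y| ≤ Φt * Real.exp (-(κ₀ * supNorm (y - y₀))))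
    (htt : ∀ κ w, |contourSumAdj N ((cψ * cχ * ((P : ℝ) ^ d * P)) • φ' - c₀ • φ) κ w| ≤ τt * Real.exp (-(κ₀ * supNorm (quo N w - y₀))))
    (ht0 : ∀ κ w, |contourSumAdj N φ κ w| ≤ τ₀ * Real.exp (-(κ₀ * supNorm (quo N w - y₀))))
    (hΔψ : ∀ u', ψ' u' - cψ * ψ (blk P u') = ∑ s ∈ Finset.range (k + 2), ΔG₁ s (blk (P ^ s) u'))
    (hGΔ₁ : ∀ s, s ≤ k + 1 → ∀ u', |ΔG₁ s (blk (P ^ s) u')| ≤ aΔ s * Real.exp (-(κ₀ * supNorm (quo (P * N) u' - c₁))))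
    (hψup : ∀ u', cψ * ψ (blk P u') = ∑ s ∈ Finset.range (k + 2), Gup₁ s (blk (P ^ s) u'))
    (hGup₁ : ∀ s, s ≤ k + 1 → ∀ u', |Gup₁ s (blk (P ^ s) u')| ≤ aup s * Real.exp (-(κ₀ * supNorm (quo (P * N) u' - c₁))))
    (hχ' : ∀ u', χ' u' = ∑ s ∈ Finset.range (k + 2), G₂' s (blk (P ^ s) u'))
    (hG₂' : ∀ s, s ≤ k + 1 → ∀ u', |G₂' s (blk (P ^ s) u')| ≤ b' s * Real.exp (-(κ₀ * supNorm (quo (P * N) u' - c₂))))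
    (hΔχ : ∀ u', χ' u' - cχ * χ (blk P u') = ∑ s ∈ Finset.range (k + 2), ΔG₂ s (blk (P ^ s) u'))
    (hGΔ₂ : ∀ s, s ≤ k + 1 → ∀ u', |ΔG₂ s (blk (P ^ s) u')| ≤ bΔ s * Real.exp (-(κ₀ * supNorm (quo (P * N) u' - c₂))))
    (hψ : ∀ w, ψ w = ∑ s ∈ Finset.range (k + 1), G₁ s (blk (P ^ s) w))
    (hG₁ : ∀ s, s ≤ k → ∀ w, |G₁ s (blk (P ^ s) w)| ≤ a s * Real.exp (-(κ₀ * supNorm (quo N w - c₁))))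
    (hχ : ∀ w, χ w = ∑ s ∈ Finset.range (k + 1), G₂ s (blk (P ^ s) w))
    (hG₂ : ∀ s, s ≤ k → ∀ w, |G₂ s (blk (P ^ s) w)| ≤ b s * Real.exp (-(κ₀ * supNorm (quo N w - c₂))))
    (hE' : Summable fun u' : Site (d + 1) => Real.exp (-(κ₀ * supNorm (quo (P * N) u' - y₀))) *
      Real.exp (-(κ₀ * supNorm (quo (P * N) u' - c₁))) * Real.exp (-(κ₀ * supNorm (quo (P * N) u' - c₂))))
    (hE : Summable fun w : Site (d + 1) => Real.exp (-(κ₀ * supNorm (quo N w - y₀))) *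
      Real.exp (-(κ₀ * supNorm (quo N w - c₁))) * Real.exp (-(κ₀ * supNorm (quo N w - c₂))))
    (κ : Fin (d + 1)) :
    |(∑' u' : Site (d + 1), contourSumAdj (P * N) φ' κ u' * (θ₀ * ψ' u' + θ₁ * ψ' (u' + unitVec κ)) * (χ' (u' + unitVec κ) - χ' u'))
        - c₀ * ∑' w : Site (d + 1), contourSumAdj N φ κ w * (θ₀ * ψ w + θ₁ * ψ (w + unitVec κ)) * (χ (w + unitVec κ) - χ w)|
      ≤ (∑ s₁ ∈ Finset.range (k + 2), ∑ s₂ ∈ Finset.range (k + 2),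
            (if s₁ ≤ s₂ then 2 * Real.exp (2 * κ₀) * τ' * aΔ s₁ * b' s₂ * (((P : ℝ) ^ s₂))⁻¹
             else 2 * Real.exp (5 * κ₀) * (Φ₀' + τ' * (((P : ℝ) ^ s₁))⁻¹) * aΔ s₁ * b' s₂)) *
          (∑' u' : Site (d + 1), Real.exp (-(κ₀ * supNorm (quo (P * N) u' - y₀))) *
            Real.exp (-(κ₀ * supNorm (quo (P * N) u' - c₁))) * Real.exp (-(κ₀ * supNorm (quo (P * N) u' - c₂))))
        + (∑ s₁ ∈ Finset.range (k + 2), ∑ s₂ ∈ Finset.range (k + 2),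
            (if s₁ ≤ s₂ then 2 * Real.exp (2 * κ₀) * τ' * aup s₁ * bΔ s₂ * (((P : ℝ) ^ s₂))⁻¹
             else 2 * Real.exp (5 * κ₀) * (Φ₀' + τ' * (((P : ℝ) ^ s₁))⁻¹) * aup s₁ * bΔ s₂)) *
          (∑' u' : Site (d + 1), Real.exp (-(κ₀ * supNorm (quo (P * N) u' - y₀))) *
            Real.exp (-(κ₀ * supNorm (quo (P * N) u' - c₁))) * Real.exp (-(κ₀ * supNorm (quo (P * N) u' - c₂))))
        + (∑ s₁ ∈ Finset.range (k + 1), ∑ s₂ ∈ Finset.range (k + 1),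
            (if s₁ ≤ s₂ then 2 * Real.exp (2 * κ₀) * τt * a s₁ * b s₂ * (((P : ℝ) ^ s₂))⁻¹
             else 2 * Real.exp (5 * κ₀) * (Φt + τt * (((P : ℝ) ^ s₁))⁻¹) * a s₁ * b s₂)) *
          (∑' w : Site (d + 1), Real.exp (-(κ₀ * supNorm (quo N w - y₀))) *
            Real.exp (-(κ₀ * supNorm (quo N w - c₁))) * Real.exp (-(κ₀ * supNorm (quo N w - c₂)))) := by
  haveI : NeZero (P * N) := ⟨Nat.mul_ne_zero (NeZero.ne P) (NeZero.ne N)⟩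
  -- sup bounds of the six staircases
  have hΔψb := abs_staircase_le (N := P * N) hΔψ hGΔ₁
  have hψupb := abs_staircase_le (N := P * N) (ψ := fun u' => cψ * ψ (blk P u')) hψup hGup₁
  have hχ'b := abs_staircase_le (N := P * N) hχ' hG₂'
  have hΔχb := abs_staircase_le (N := P * N) hΔχ hGΔ₂
  have hχupb : ∀ u', |cχ * χ (blk P u')|
      ≤ ((∑ s ∈ Finset.range (k + 2), b' s) + ∑ s ∈ Finset.range (k + 2), bΔ s) * Real.exp (-(κ₀ * supNorm (quo (P * N) u' - c₂))) := by
    intro u'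
    have e : cχ * χ (blk P u') = χ' u' - (χ' u' - cχ * χ (blk P u')) := by ring
    rw [e, add_mul]
    exact (abs_sub _ _).trans (add_le_add (hχ'b u') (hΔχb u'))
  have hψb := abs_staircase_le (N := N) hψ hG₁
  have hχb := abs_staircase_le (N := N) hχ hG₂
  have htc : ∀ κ w, |contourSumAdj N φ' κ w| ≤ τ' * Real.exp (-(κ₀ * supNorm (quo N w - y₀))) :=
    abs_contourSumAdj_coarse_le_of_fine hP N ht'
  -- the five summabilities of the identity
  have hS1 := summable_pairing_of_env (N := P * N) hκ hθ ht' hΔψb hχ'b hE' κ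
  have hS2 := summable_pairing_of_env (N := P * N) (χ := fun u' => χ' u' - cχ * χ (blk P u')) hκ hθ ht' hψupb hΔχb hE' κ
  have hS3 := summable_pairing_of_env (N := P * N) (χ := fun u' => cχ * χ (blk P u')) hκ hθ ht' hψupb hχupb hE' κ
  have hS4 := summable_pairing_of_env (N := N) hκ hθ htc hψb hχb hE κ
  have hS5 := summable_pairing_of_env (N := N) hκ hθ ht0 hψb hχb hE κ
  rw [pairing_refine_eq hP N φ' φ ψ' χ' ψ χ cψ cχ c₀ θ₀ θ₁ κ hS1 hS2 hS3 hS4 hS5]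
  -- the three brackets, each by the owner's pairing lemma
  have h1 := abs_pairingReading_le_sum (N := P * N) (Lc := P) (k := k + 1) (y₀ := y₀) (c₁ := c₁) (c₂ := c₂) (φ := φ') (G₁ := ΔG₁) (G₂ := G₂')
    (a := aΔ) (b := b') hκ hτ' hΦ' hP haΔ hb' hθ hdvd' hφ' ht' hGΔ₁ hG₂' hE'
    (ψ := fun u' => ψ' u' - cψ * ψ (blk P u')) (χ := χ') hΔψ hχ' κ
  have h2 := abs_pairingReading_le_sum (N := P * N) (Lc := P) (k := k + 1) (y₀ := y₀) (c₁ := c₁) (c₂ := c₂) (φ := φ') (G₁ := Gup₁) (G₂ := ΔG₂)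
    (a := aup) (b := bΔ) hκ hτ' hΦ' hP haup hbΔ hθ hdvd' hφ' ht' hGup₁ hGΔ₂ hE'
    (ψ := fun u' => cψ * ψ (blk P u')) (χ := fun u' => χ' u' - cχ * χ (blk P u')) hψup hΔχ κ
  have h3 := abs_pairingReading_le_sum (N := N) (Lc := P) (k := k) (y₀ := y₀) (c₁ := c₁) (c₂ := c₂)
    (φ := (cψ * cχ * ((P : ℝ) ^ d * P)) • φ' - c₀ • φ) (G₁ := G₁) (G₂ := G₂)
    (a := a) (b := b) hκ hτt hΦt hP ha hb hθ hdvd hφt htt hG₁ hG₂ hE hψ hχ κ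
  refine (abs_add_le _ _).trans (add_le_add ((abs_add_le _ _).trans (add_le_add h1 h2)) h3)

end Schema

end Summit.QuantumFields.BalabanUV.Beta.GAN24.ContactRefineP

end
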